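import Mathlib
import Summits.Langlands.Langlands.Theses.ParityBlindBianchi
import Summits.Langlands.Langlands.Theorems.ParityBlindBianchiIcosahedralDescentLevelBC

/-!
# Skeleton v3 (line `Sketch`, lead prover-line-stmt-Langlands-16852-0) for crux stmt-Langlands-16852
# `IcosahedralDescentLevelBC` (D″BC of route ParityBlindBianchi)

The crux is `QuadraticDescentGL2 → QuadraticBaseChangeGL2 → IcosahedralDescentLevelR` by `rfl`.  The line
re-plumbs the landed F1–F4 proof of D′R (p111861) over the crux's own antecedents; ALL of it is now
LANDED in the tree and imported here:

* `stub_anchorDescentBC` — p142981 (`Theorems/ParityBlindBianchiIcosahedralDescentLevelBCStubAnchorDescentBC.lean`);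
* `stub_readOffBC` — p142990 (`Theorems/ParityBlindBianchiIcosahedralDescentLevelBCStubReadOffBC.lean`);
* the composition `pair_dichotomy_bc → exists_isPiOfArtinRep_of_uniform_bc → icosahedralDescentLevelBC_repaired`
  and the crux BY NAME granted A–C Ch. 3 Thm 3.1 at rank 2 — `icosahedralDescentLevelBC_of_fibresTwo` —
  p143688 (`Theorems/ParityBlindBianchiIcosahedralDescentLevelBC.lean`, `--workitem`, `proof.conditional`),
  together with `icosahedralDescentLevelBC_of_fibres (hfib : ArthurClozel_fibres_quadratic)` (trust base
  = the one all-rank named fact F4) and (append pending) `icosahedralDescentLevelBC_of_gl2_at_one (h22) (hm1)`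
  (trust base = Jacquet–Shalika (2.2) at `s = 1` for `GL₂ × GL₂` and multiplicity one for `GL₂` only, through
  the Literature reductions p143404 `ArthurClozelFibresRankTwo` and p144278 `ArthurClozelFibresShiftKilling`).

So the skeleton is CLOSED MODULO exactly one registered stub, `stub_fibresTwo` = the `n := 2` slice of the
tree's undischarged named fact `Literature.NumberTheory.Automorphic.ArthurClozel_fibres_quadratic`
(A–C Ch. 3 Thm 3.1; Langlands 1980 for `GL₂`).  It is a NAMED-FACT debt, not a lemma any line can prove
short of the analytic theory: sufficient inputs present in the tree as named facts are F4 itself, or the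
pair {`JacquetShalika1981_partialPairL_at_one_of_ne_conj` at `n = 2`, `multiplicity_one_gl 2`}.
Closing move once either is a theorem: replace the `sorry` below by `ArthurClozel_fibres_quadratic_holds 2`
(resp. `ArthurClozel_fibres_quadratic_two_of_gl2_at_one h22_holds hm1_holds`) and propose this file
`--workitem stmt-Langlands-16852`.

History: v1 (3 stubs, 05:08Z) → v2 (stubs 1–2 landed, 05:30Z) → v3 (composition landed; this file).
-/

-- `Summit.Langlands.Langlands.…`: the repeated path component is the tree's layout (D-0017).
set_option linter.dupNamespace false

noncomputable section

open scoped NumberField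
open NumberField IsDedekindDomain Filter
open Literature.NumberTheory.Automorphic
open Summit.Langlands.Langlands.Theses.ParityBlindBianchi

namespace Summit.Langlands.Langlands.Theorems.IcosahedralDescentLevelBC

/-- STUB (XL named-fact debt): **fibres of quadratic base change at rank 2** — Arthur–Clozel Ch. 3
Thm 3.1 for `GL₂` (also Langlands 1980): for a quadratic extension `M/K` of number fields and cuspidal
`π, π'` on `GL₂(𝔸_K)` with `t_{π,w}^{f(x|w)} = t_{π',w}^{f(x|w)}` for almost all places `x` of `M`,
either `t_{π'} = t_π` a.e. or `t_{π',w} = ε_{M/K}(w) t_{π,w}` a.e.  Verbatim the `n := 2` slice of the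
tree's named fact `Literature.NumberTheory.Automorphic.ArthurClozel_fibres_quadratic` (undischarged);
reduced in the tree to {JS (2.2) at `s = 1` for `GL₂ × GL₂`, multiplicity one for `GL₂`}
(`ArthurClozel_fibres_quadratic_two_of_gl2_at_one`, p144278). [cite: ArthurClozelAMS120, Ch. 3 Thm. 3.1] -/
theorem stub_fibresTwo :
    ∀ (K M : Type) [Field K] [NumberField K] [Field M] [NumberField M] [Algebra K M],
      Module.finrank K M = 2 → ∀ (hK : isCompact_glFiniteIntegralLevel 2 K)
        (π π' : CuspidalAutomorphicRepData 2 K hK),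
        (∀ᶠ x : HeightOneSpectrum (𝓞 M) in Filter.cofinite,
          ∀ (w : HeightOneSpectrum (𝓞 K)) (α α' : Multiset ℂ), x.asIdeal.under (𝓞 K) = w.asIdeal →
            π.1.HasSatakeParamAt w α → π'.1.HasSatakeParamAt w α' →
              α.map (· ^ x.asIdeal.inertiaDeg (𝓞 K)) = α'.map (· ^ x.asIdeal.inertiaDeg (𝓞 K))) →
        (∀ᶠ w : HeightOneSpectrum (𝓞 K) in Filter.cofinite, ∀ α : Multiset ℂ,
            π.1.HasSatakeParamAt w α → π'.1.HasSatakeParamAt w α) ∨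
        (∀ᶠ w : HeightOneSpectrum (𝓞 K) in Filter.cofinite, ∀ α : Multiset ℂ,
            π.1.HasSatakeParamAt w α → π'.1.HasSatakeParamAt w (α.map (quadraticSign M w * ·))) := by
  sorry

/-- **Skeleton conclusion.**  `IcosahedralDescentLevelBC` BY NAME from the one registered stub, through
the LANDED conditional theorem `icosahedralDescentLevelBC_of_fibresTwo` (p143688). [folklore] -/
theorem IcosahedralDescentLevelBC_of : IcosahedralDescentLevelBC :=
  icosahedralDescentLevelBC_of_fibresTwo stub_fibresTwo

end Summit.Langlands.Langlands.Theorems.IcosahedralDescentLevelBC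

end
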